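import Summits.Ventures.PercRepro.ThetaOmegaSplit

/-!
# (Ω) on one and two members: the exceptional configurations

Dossier proofs/MINE1-theoremS.md, Addendum 80 (mine-1, gen 41). The (Ω)-bound `|F| ≤ Ω(F)`
fails by exactly one for a single member `s` with `c0 s ≠ c1 s` and for exactly two kinds of pairs
`{s, t}`: both members mono (`c0 = c1`) of different colours, or one of them `∅` with
`c1 ∅ ≠ γ` while the other is mono of colour `γ`; every other family of at most two members
satisfies the bound. This file proves the bound outside these configurations — the base of the
ground-set induction of `ThetaOmegaSplit.lean`, where the edge family `K` of a point with at most
two edges is handled by it: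

* `empty_mem_omegaA_of_mono`, `omegaCount_pos_of_mono` — a mono member puts `∅` into `A`;
* `two_le_omegaCount_of_pair` — **the two-member bound** outside the exceptional pairs;
* `OmegaExc`, `card_le_omegaCount_of_card_le_two` — the bound on at most two members outside the
  exceptional configurations;
* `card_le_omegaCount_of_edges_le_two` — **the induction step through a point with at most two
  edges**: if the edge family with its induced colours is not exceptional and the oriented
  projection satisfies its bound, so does `F`.
-/

namespace PercRepro.MSTight

open Finset

variable {α : Type*} [DecidableEq α]

section Small

variable {U : Finset α} {F : Finset (Finset α)} {c0 c1 : Finset α → Bool}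

/-- A member with `c0 s = c1 s` puts `∅ = s \ s` into the `A`-family. -/
theorem empty_mem_omegaA_of_mono {s : Finset α} (hs : s ∈ F) (h : c0 s = c1 s) :
    ∅ ∈ omegaA F c0 c1 := by
  have := sdiff_mem_omegaA hs hs h
  rwa [sdiff_self, bot_eq_empty] at this

/-- A mono member gives `1 ≤ Ω`. -/
theorem omegaCount_pos_of_mono {s : Finset α} (hs : s ∈ F) (h : c0 s = c1 s) :
    1 ≤ omegaCount U F c0 c1 := by
  unfold omegaCount
  have := card_pos.2 ⟨∅, empty_mem_omegaA_of_mono hs h⟩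
  omega

/-- Two distinct members give a family of at least two elements. -/
theorem two_le_card_of_two_mem {G : Finset (Finset α)} {x y : Finset α} (hx : x ∈ G) (hy : y ∈ G)
    (hxy : x ≠ y) : 2 ≤ G.card := by
  have : ({x, y} : Finset (Finset α)) ⊆ G := by
    intro z hz
    rcases mem_insert.1 hz with rfl | hz
    · exact hx
    · rw [mem_singleton.1 hz]; exact hy
  exact (card_pair hxy) ▸ card_le_card this

/-- The two differences of distinct sets are distinct. -/
theorem sdiff_ne_sdiff_of_ne {s t : Finset α} (hst : s ≠ t) : s \ t ≠ t \ s := by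
  intro h
  apply hst
  have h1 : s \ t = ∅ := by
    apply eq_empty_of_forall_notMem
    intro a ha
    have ha' : a ∈ t \ s := h ▸ ha
    exact (mem_sdiff.1 ha').2 (mem_sdiff.1 ha).1
  have h2 : t \ s = ∅ := h ▸ h1
  exact Subset.antisymm (sdiff_eq_empty_iff_subset.1 h1) (sdiff_eq_empty_iff_subset.1 h2)

/-- **The two-member bound.** For distinct members `s, t` of `F`, `2 ≤ Ω(F)` unless both are
mono of different colours, or one of them is `∅` with `c1 ∅ ≠ γ` while the other is mono of
colour `γ`. -/
theorem two_le_omegaCount_of_pair {s t : Finset α} (hs : s ∈ F) (ht : t ∈ F) (hst : s ≠ t)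
    (hmono : ¬ (c0 s = c1 s ∧ c0 t = c1 t ∧ c0 s ≠ c0 t))
    (hes : ¬ (s = ∅ ∧ c0 t = c1 t ∧ c1 s ≠ c0 t))
    (het : ¬ (t = ∅ ∧ c0 s = c1 s ∧ c1 t ≠ c0 s)) :
    2 ≤ omegaCount U F c0 c1 := by
  unfold omegaCount
  have hA2 : ∀ x y, x ∈ omegaA F c0 c1 → y ∈ omegaA F c0 c1 → x ≠ y →
      2 ≤ (omegaA F c0 c1).card + (omegaC U F c1).card := fun x y hx hy hxy =>
    le_trans (two_le_card_of_two_mem hx hy hxy) (Nat.le_add_right _ _)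
  have hAC : ∀ x y, x ∈ omegaA F c0 c1 → y ∈ omegaC U F c1 →
      2 ≤ (omegaA F c0 c1).card + (omegaC U F c1).card := fun x y hx hy =>
    Nat.add_le_add (card_pos.2 ⟨x, hx⟩) (card_pos.2 ⟨y, hy⟩)
  have hmeet : c0 s = c0 t → s ⊓ t ∈ omegaA F c0 c1 := fun h => inf_mem_omegaA hst hs ht h
  have hD1 : c0 s = c1 t → s \ t ∈ omegaA F c0 c1 := fun h => sdiff_mem_omegaA hs ht h
  have hD2 : c0 t = c1 s → t \ s ∈ omegaA F c0 c1 := fun h => sdiff_mem_omegaA ht hs h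
  have hE1 : c0 s = c1 s → ∅ ∈ omegaA F c0 c1 := fun h => empty_mem_omegaA_of_mono hs h
  have hE2 : c0 t = c1 t → ∅ ∈ omegaA F c0 c1 := fun h => empty_mem_omegaA_of_mono ht h
  have hco : c1 s = c1 t → U \ (s ⊔ t) ∈ omegaC U F c1 := fun h => sdiff_sup_mem_omegaC hst hs ht h
  by_cases hb : c1 s = c1 t
  · -- a co-join is available; one element of `A` suffices
    have hC := hco hb
    by_cases ha : c0 s = c1 s
    · exact hAC _ _ (hE1 ha) hC
    · by_cases ha' : c0 t = c1 t
      · exact hAC _ _ (hE2 ha') hC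
      · have h' : c0 t ≠ c1 s := fun h => ha' (h.trans hb)
        exact hAC _ _ (hmeet (bool_eq_of_ne_of_ne ha h')) hC
  · -- no co-join: two distinct elements of `A`
    by_cases ha : c0 s = c0 t
    · have hM := hmeet ha
      by_cases hab : c0 s = c1 s
      · -- `∅`, `s ⊓ t`, `t \ s` are in `A`
        have h2 := hD2 (ha.symm.trans hab)
        by_cases hts : t \ s = ∅
        · -- `t ⊆ s`, so `s ⊓ t = t`, and `t ≠ ∅` (else exceptional)
          have htsub : t ⊆ s := sdiff_eq_empty_iff_subset.1 hts
          have ht0 : t ≠ ∅ := by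
            intro ht0
            exact het ⟨ht0, hab, fun h => hb (hab.symm.trans h.symm)⟩
          exact hA2 _ _ (hE1 hab) hM (by rw [inf_eq_right.2 htsub]; exact Ne.symm ht0)
        · exact hA2 _ _ (hE1 hab) h2 (Ne.symm hts)
      · -- `c0 s = c1 t` (both differ from `c1 s`), so `s \ t ∈ A` and `t` is mono: `∅ ∈ A`
        have hsb' : c0 s = c1 t := bool_eq_of_ne_of_ne hab (Ne.symm hb)
        have h1 := hD1 hsb'
        have h2 := hE2 (ha.symm.trans hsb')
        by_cases hst0 : s \ t = ∅
        · have hssub : s ⊆ t := sdiff_eq_empty_iff_subset.1 hst0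
          have hs0 : s ≠ ∅ := by
            intro hs0
            exact hes ⟨hs0, ha.symm.trans hsb', fun h => hab (ha.trans h.symm)⟩
          exact hA2 _ _ h2 hM (by rw [inf_eq_left.2 hssub]; exact Ne.symm hs0)
        · exact hA2 _ _ h2 h1 (Ne.symm hst0)
    · -- `c0 s ≠ c0 t` and `c1 s ≠ c1 t`
      by_cases h1 : c0 s = c1 s
      · exfalso
        apply hmono
        refine ⟨h1, ?_, ha⟩
        exact bool_eq_of_ne_of_ne (Ne.symm ha) (fun h => hb (h1.symm.trans h.symm))
      · -- `c0 t = c1 s` and `c0 s = c1 t`: the two differences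
        have hts : c0 t = c1 s := bool_eq_of_ne_of_ne (Ne.symm ha) (Ne.symm h1)
        have hst' : c0 s = c1 t := bool_eq_of_ne_of_ne h1 (Ne.symm hb)
        exact hA2 _ _ (hD1 hst') (hD2 hts) (sdiff_ne_sdiff_of_ne hst)

end Small

section Exceptional

variable {U : Finset α} {F : Finset (Finset α)} {c0 c1 : Finset α → Bool}

/-- **The exceptional pairs**: two distinct members both mono of different colours, or one of
them `∅` with `c1 ∅ ≠ γ` while the other is mono of colour `γ`. -/
def OmegaExcPair (c0 c1 : Finset α → Bool) (s t : Finset α) : Prop :=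
  (c0 s = c1 s ∧ c0 t = c1 t ∧ c0 s ≠ c0 t) ∨ (s = ∅ ∧ c0 t = c1 t ∧ c1 s ≠ c0 t) ∨
    (t = ∅ ∧ c0 s = c1 s ∧ c1 t ≠ c0 s)

/-- **The exceptional configurations** of a family of at most two members: a single member with
`c0 s ≠ c1 s`, or an exceptional pair. -/
def OmegaExc (c0 c1 : Finset α → Bool) (F : Finset (Finset α)) : Prop :=
  (∃ s ∈ F, F = {s} ∧ c0 s ≠ c1 s) ∨ ∃ s ∈ F, ∃ t ∈ F, s ≠ t ∧ OmegaExcPair c0 c1 s t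

/-- **The (Ω)-bound on at most two members** outside the exceptional configurations. -/
theorem card_le_omegaCount_of_card_le_two (h2 : F.card ≤ 2) (hexc : ¬ OmegaExc c0 c1 F) :
    F.card ≤ omegaCount U F c0 c1 := by
  rcases Nat.lt_or_ge F.card 1 with h0 | h1
  · omega
  rcases Nat.lt_or_ge F.card 2 with h1' | h2'
  · -- exactly one member
    have hc : F.card = 1 := by omega
    obtain ⟨s, hF⟩ := card_eq_one.1 hc
    have hs : s ∈ F := by rw [hF]; exact mem_singleton_self s
    have hmono : c0 s = c1 s := by
      by_contra h
      exact hexc (Or.inl ⟨s, hs, hF, h⟩)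
    rw [hc]
    exact omegaCount_pos_of_mono hs hmono
  · -- exactly two members
    have hc : F.card = 2 := by omega
    obtain ⟨s, t, hst, hF⟩ := card_eq_two.1 hc
    have hs : s ∈ F := by rw [hF]; exact mem_insert_self s {t}
    have ht : t ∈ F := by rw [hF]; exact mem_insert_of_mem (mem_singleton_self t)
    have hpair : ¬ OmegaExcPair c0 c1 s t := fun h => hexc (Or.inr ⟨s, hs, t, ht, hst, h⟩)
    rw [hc]
    refine two_le_omegaCount_of_pair hs ht hst ?_ ?_ ?_
    · exact fun h => hpair (Or.inl h)
    · exact fun h => hpair (Or.inr (Or.inl h))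
    · exact fun h => hpair (Or.inr (Or.inr h))

/-- **The induction step through a point with at most two edges**: if the edge family (coloured by
`c0 ∘ insert q` and `c1`) is not exceptional and the oriented projection satisfies its bound, so
does `F`. -/
theorem card_le_omegaCount_of_edges_le_two {q : α} {o : Finset α → Bool} (hq : q ∈ U)
    (ho : ValidOrient q F o) (hK2 : (qEdges q F).card ≤ 2)
    (hKexc : ¬ OmegaExc (edgeC0 q c0) c1 (qEdges q F))
    (hP : (projFam q F).card ≤
      omegaCount (U.erase q) (projFam q F) (projColour q o c0) (projColour q o c1)) :
    F.card ≤ omegaCount U F c0 c1 :=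
  card_le_omegaCount_of_step hq ho hP (card_le_omegaCount_of_card_le_two hK2 hKexc)

end Exceptional

end PercRepro.MSTight
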